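import Literature.Analysis.FluidPDE.QuasiSelfSimilarCompatibleBlocks
import Literature.Analysis.FluidPDE.QuasiSelfSimilarFamilyProofs
import Literature.Analysis.FluidPDE.QuasiSelfSimilarPlanarProofs
import Literature.Analysis.FluidPDE.BoxTransportConservation
import Literature.Analysis.FunctionSpaces.TorusPatchingGlue
import HarnessLib

/-!
# From compatible blocks to the building blocks of BDL Thm. 4.1 (proofs)

Topic `Literature/Analysis/FluidPDE`; proofs file for `QuasiSelfSimilarCompatibleBlocks.lean`.
Main result: `acm_building_blocks_of_compatible_blocks : acm_compatible_blocks → acm_building_blocks`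
— the structural fact behind Bruè–De Lellis, CMP 400 (2023), Thm. 4.1
(`QuasiSelfSimilarBuildingBlocks.lean`) follows from the finer kinematic fact
`acm_compatible_blocks` (Alberti–Crippa–Mazzucato 2019, §8.1, §8.4 (a)–(c), §8.5–8.6), with the
explicit labels `QuasiSelfSimilar.blockLabel` (ACM §6.2). Consequently the torus family
(`alberti_crippa_mazzucato_family_of_compatible_blocks`) and the planar family
(`alberti_crippa_mazzucato_planar_family_of_compatible_blocks`) of BDL Thm. 4.1 follow from
`acm_compatible_blocks` alone.

Contents (all proved):
* arithmetic of the labels: `2·5ⁿ`-periodicity of `blockLabel n` (`blockLabel_add_mesh_smul`,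
  `blockLabel_emod`), parent/digit identities;
* the gate-consistency induction of ACM §6.2/§8.6 (`not_gate_lo_of_dvd`, `not_gate_hi_of_dvd`,
  `gate_lo_iff_gate_hi`): at every level, a cell has a gate on a side iff the neighbour across that
  side has the gate on the opposite side, and no cell has a gate on `∂[0,1]²`;
* local compatibility of the placed blocks (`patchCompatible_blocks`), hence smoothness of the
  patched fields on `ℝ × T²` (`TorusPatchingGlue`), per-level supports in the open square, the
  handover `ρ_n(1) = ρ_{n+1}(0)` (self-similarity on the open subsquares + continuity), and zero
  average / unit mass for all `t ∈ [0,1]` (`BoxTransportConservation`).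

## References

* G. Alberti, G. Crippa, A. L. Mazzucato, *Exponential self-similar mixing by incompressible
  flows*, J. Amer. Math. Soc. 32 (2019), §6.2, Rem. 24 (iv), §8.1, §8.4–8.8 (arXiv:1605.02090).
* E. Bruè, C. De Lellis, *Anomalous dissipation for the forced 3D Navier–Stokes equations*,
  Comm. Math. Phys. 400 (2023), §4.1, Thm. 4.1, (4.3)–(4.4).
-/

noncomputable section

open MeasureTheory Set Filter Function

open scoped Topology ContDiff

namespace Literature.Analysis.FluidPDE

namespace QuasiSelfSimilar

open FunctionSpaces FunctionSpaces.Torus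

/-! ## Arithmetic of the labels -/

section Arithmetic

variable {N : ℕ} (child : Fin N → (Fin 2 → Fin 5) → Fin N) (seed : (Fin 2 → Fin 2) → Fin N)

/-- The digit as an integer: `digit5 κ k = κ k mod 5`. [folklore] -/
theorem natCast_digit5 (κ : Fin 2 → ℤ) (k : Fin 2) : ((digit5 κ k : ℕ) : ℤ) = κ k % 5 := by
  show (((κ k % 5).toNat : ℕ) : ℤ) = κ k % 5
  exact Int.toNat_of_nonneg (Int.emod_nonneg _ (by norm_num))

/-- The seed position as an integer: `seedIndex κ k = κ k mod 2`. [folklore] -/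
theorem natCast_seedIndex (κ : Fin 2 → ℤ) (k : Fin 2) : ((seedIndex κ k : ℕ) : ℤ) = κ k % 2 := by
  show (((κ k % 2).toNat : ℕ) : ℤ) = κ k % 2
  exact Int.toNat_of_nonneg (Int.emod_nonneg _ (by norm_num))

/-- `κ = 5 ⌊κ/5⌋ + (κ mod 5)` coordinatewise. [folklore] -/
theorem parent5_digit5 (κ : Fin 2 → ℤ) (k : Fin 2) :
    5 * parent5 κ k + ((digit5 κ k : ℕ) : ℤ) = κ k := by
  rw [natCast_digit5]
  show 5 * (κ k / 5) + κ k % 5 = κ k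
  omega

/-- The mesh recursion `m_{n+1} = 5 m_n`. [folklore] -/
theorem mesh_succ (n : ℕ) : mesh (n + 1) = 5 * mesh n := by
  unfold mesh; ring

/-- The mesh as an integer is positive. [folklore] -/
theorem mesh_int_pos (n : ℕ) : (0 : ℤ) < mesh n := by exact_mod_cast mesh_pos n

/-- `seedIndex` is `2`-periodic. [folklore] -/
theorem seedIndex_add_two_smul (κ v : Fin 2 → ℤ) : seedIndex (κ + (2 : ℤ) • v) = seedIndex κ := by
  funext k
  apply Fin.ext
  show ((κ + (2 : ℤ) • v) k % 2).toNat = (κ k % 2).toNat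
  congr 1
  simp [Pi.add_apply, Int.add_mul_emod_self_left]

/-- `digit5` is `5`-periodic. [folklore] -/
theorem digit5_add_five_smul (κ v : Fin 2 → ℤ) : digit5 (κ + (5 : ℤ) • v) = digit5 κ := by
  funext k
  apply Fin.ext
  show ((κ + (5 : ℤ) • v) k % 5).toNat = (κ k % 5).toNat
  congr 1
  simp [Pi.add_apply, Int.add_mul_emod_self_left]

/-- `parent5 (κ + 5 v) = parent5 κ + v`. [folklore] -/
theorem parent5_add_five_smul (κ v : Fin 2 → ℤ) : parent5 (κ + (5 : ℤ) • v) = parent5 κ + v := by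
  funext k
  show (κ + (5 : ℤ) • v) k / 5 = κ k / 5 + v k
  simp only [Pi.add_apply, Pi.smul_apply, smul_eq_mul]
  rw [Int.add_mul_ediv_left _ _ (by norm_num : (5 : ℤ) ≠ 0)]

/-- **Periodicity of the labels**: `blockLabel n (κ + 2·5ⁿ v) = blockLabel n κ`. [folklore] -/
theorem blockLabel_add_mesh_smul (n : ℕ) (κ v : Fin 2 → ℤ) :
    blockLabel child seed n (κ + (mesh n : ℤ) • v) = blockLabel child seed n κ := by
  induction n generalizing κ v with
  | zero =>
    rw [blockLabel_zero, blockLabel_zero]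
    have : (mesh 0 : ℤ) = 2 := by simp [mesh]
    rw [this, seedIndex_add_two_smul]
  | succ n ih =>
    rw [blockLabel_succ, blockLabel_succ]
    have hm : (mesh (n + 1) : ℤ) • v = (5 : ℤ) • ((mesh n : ℤ) • v) := by
      rw [mesh_succ, smul_smul]; push_cast; ring_nf
    rw [hm, digit5_add_five_smul, parent5_add_five_smul, ih]

/-- The labels read modulo the mesh are the labels. [folklore] -/
theorem blockLabel_emod (n : ℕ) (κ : Fin 2 → ℤ) :
    blockLabel child seed n (fun i => κ i % (mesh n : ℤ)) = blockLabel child seed n κ := by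
  have h : (fun i => κ i % (mesh n : ℤ)) = κ + (mesh n : ℤ) • fun i => -(κ i / (mesh n : ℤ)) := by
    funext i
    simp only [Pi.add_apply, Pi.smul_apply, smul_eq_mul, Int.emod_def]
    ring
  rw [h, blockLabel_add_mesh_smul]

/-- The periodised label map of `Torus.lift_patchTorus` is the label map itself. [folklore] -/
theorem blockLabel_comp_emod (n : ℕ) :
    (fun κ : Fin 2 → ℤ => blockLabel child seed n fun i => κ i % (mesh n : ℕ)) =
      blockLabel child seed n := by
  funext κ
  exact blockLabel_emod child seed n κ

end Arithmetic

/-! ## Gate consistency (ACM §6.2, §8.6) -/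

section Gates

variable {N : ℕ} {V : Fin N → ℝ → EuclideanSpace ℝ (Fin 2) → EuclideanSpace ℝ (Fin 2)}
  {Θ : Fin N → ℝ → EuclideanSpace ℝ (Fin 2) → ℝ} {gate : Fin N → Fin 2 → Bool → Prop}
  {child : Fin N → (Fin 2 → Fin 5) → Fin N} {seed : (Fin 2 → Fin 2) → Fin N}
  {Vg : Fin 2 → ℝ → EuclideanSpace ℝ (Fin 2) → EuclideanSpace ℝ (Fin 2)}
  {Θg : Fin 2 → ℝ → EuclideanSpace ℝ (Fin 2) → ℝ} {δ : ℝ}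

/-- `digit5` of a lower neighbour inside the same parent: if `κ_k mod 5 ≠ 0` then
`digit5 κ = update (digit5 (κ - e_k)) k (digit5 (κ - e_k) k + 1)` and the parents agree. [folklore] -/
theorem digit5_sub_single_of_ne (κ : Fin 2 → ℤ) (k : Fin 2) (h : κ k % 5 ≠ 0) :
    parent5 (κ - Pi.single k 1) = parent5 κ ∧
      (digit5 (κ - Pi.single k 1) k : ℕ) + 1 = (digit5 κ k : ℕ) ∧
      ∀ j, j ≠ k → digit5 (κ - Pi.single k 1) j = digit5 κ j := by
  have hd : ((digit5 κ k : ℕ) : ℤ) = κ k % 5 := natCast_digit5 κ k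
  have hd' : ((digit5 (κ - Pi.single k 1) k : ℕ) : ℤ) = (κ k - 1) % 5 := by
    rw [natCast_digit5]; simp
  -- `(κ_k - 1) = 5 (κ_k / 5) + (κ_k % 5 - 1)` with `0 ≤ κ_k % 5 - 1 < 5`
  have hq : (κ k - 1) / 5 = κ k / 5 ∧ (κ k - 1) % 5 = κ k % 5 - 1 := by omega
  refine ⟨?_, ?_, ?_⟩
  · funext j
    show (κ - Pi.single k 1 : Fin 2 → ℤ) j / 5 = κ j / 5
    by_cases hj : j = k
    · subst hj; simp [hq.1]
    · simp [Pi.single_eq_of_ne hj]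
  · have : ((digit5 (κ - Pi.single k 1) k : ℕ) : ℤ) + 1 = ((digit5 κ k : ℕ) : ℤ) := by
      rw [hd, hd', hq.2]; ring
    exact_mod_cast this
  · intro j hj
    apply Fin.ext
    show ((κ - Pi.single k 1 : Fin 2 → ℤ) j % 5).toNat = (κ j % 5).toNat
    simp [Pi.single_eq_of_ne hj]

/-- `digit5` of a lower neighbour across the parent's side: if `κ_k mod 5 = 0` then the neighbour
`κ - e_k` has digit `4` in direction `k`, the same other digit, and parent `parent5 κ - e_k`. [folklore] -/
theorem digit5_sub_single_of_eq (κ : Fin 2 → ℤ) (k : Fin 2) (h : κ k % 5 = 0) :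
    parent5 (κ - Pi.single k 1) = parent5 κ - Pi.single k 1 ∧
      (digit5 (κ - Pi.single k 1) k : ℕ) = 4 ∧ (digit5 κ k : ℕ) = 0 ∧
      ∀ j, j ≠ k → digit5 (κ - Pi.single k 1) j = digit5 κ j := by
  have hq : (κ k - 1) / 5 = κ k / 5 - 1 ∧ (κ k - 1) % 5 = 4 := by omega
  refine ⟨?_, ?_, ?_, ?_⟩
  · funext j
    show (κ - Pi.single k 1 : Fin 2 → ℤ) j / 5 = (parent5 κ - Pi.single k 1 : Fin 2 → ℤ) j
    by_cases hj : j = k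
    · subst hj; simp [parent5, hq.1]
    · simp [parent5, Pi.single_eq_of_ne hj]
  · have : (((digit5 (κ - Pi.single k 1) k : ℕ) : ℤ)) = 4 := by
      rw [natCast_digit5]; simpa using hq.2
    exact_mod_cast this
  · have : (((digit5 κ k : ℕ) : ℤ)) = 0 := by rw [natCast_digit5, h]
    exact_mod_cast this
  · intro j hj
    apply Fin.ext
    show ((κ - Pi.single k 1 : Fin 2 → ℤ) j % 5).toNat = (κ j % 5).toNat
    simp [Pi.single_eq_of_ne hj]

/-- Divisibility by `5 M` forces digit `0` and a parent divisible by `M`. [folklore] -/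
theorem dvd_parent5_of_dvd {M : ℤ} {κ : Fin 2 → ℤ} {k : Fin 2} (h : 5 * M ∣ κ k) :
    κ k % 5 = 0 ∧ M ∣ parent5 κ k := by
  obtain ⟨q, hq⟩ := h
  refine ⟨?_, ?_⟩
  · rw [hq, mul_assoc]; simp
  · show M ∣ κ k / 5
    rw [hq, mul_assoc, Int.mul_ediv_cancel_left _ (by norm_num : (5 : ℤ) ≠ 0)]
    exact dvd_mul_right _ _

/-- Divisibility of `κ_k + 1` by `5 M` forces digit `4` and `M ∣ ⌊κ_k/5⌋ + 1`. [folklore] -/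
theorem dvd_parent5_succ_of_dvd {M : ℤ} {κ : Fin 2 → ℤ} {k : Fin 2} (h : 5 * M ∣ κ k + 1) :
    κ k % 5 = 4 ∧ M ∣ parent5 κ k + 1 := by
  obtain ⟨q, hq⟩ := h
  have hk : κ k = 5 * (M * q - 1) + 4 := by linarith
  have huniq := (Int.ediv_emod_unique (a := κ k) (b := 5) (r := 4) (q := M * q - 1)
    (by norm_num)).2 ⟨by linarith, by norm_num, by norm_num⟩
  refine ⟨huniq.2, ?_⟩
  show M ∣ κ k / 5 + 1
  rw [huniq.1]
  exact ⟨q, by ring⟩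

/-- If `5 ∣ κ_k` but `5M ∤ κ_k` then `M ∤ ⌊κ_k/5⌋`. [folklore] -/
theorem not_dvd_parent5 {M : ℤ} {κ : Fin 2 → ℤ} {k : Fin 2} (h5 : κ k % 5 = 0)
    (h : ¬ 5 * M ∣ κ k) : ¬ M ∣ parent5 κ k := by
  rintro ⟨q, hq⟩
  apply h
  have : κ k = 5 * (κ k / 5) := by omega
  refine ⟨q, ?_⟩
  rw [this]
  show 5 * parent5 κ k = 5 * M * q
  rw [hq]; ring

variable (hS : IsCompatibleBlockSystem V Θ gate child seed Vg Θg δ)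
include hS

/-- **No gate on the lower outer sides**: if `2·5ⁿ ∣ κ_k`, the block placed on the cell `κ` at
level `n` has no gate on its face `{z_k = 0}` (induction on `n`: seed, then `child_boundary_lo`).
[cite: AlbertiCrippaMazzucato2019, §8.6] -/
theorem IsCompatibleBlockSystem.not_gate_lo_of_dvd (n : ℕ) (κ : Fin 2 → ℤ) (k : Fin 2) (h : (mesh n : ℤ) ∣ κ k) :
    ¬ gate (blockLabel child seed n κ) k false := by
  induction n generalizing κ with
  | zero =>
    rw [blockLabel_zero]
    apply hS.seed_boundary_lo
    have h2 : κ k % 2 = 0 := by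
      have : (mesh 0 : ℤ) = 2 := by simp [mesh]
      rw [this] at h
      exact Int.emod_eq_zero_of_dvd h
    have : ((seedIndex κ k : ℕ) : ℤ) = 0 := by rw [natCast_seedIndex, h2]
    exact_mod_cast this
  | succ n ih =>
    rw [blockLabel_succ]
    have h' : (5 : ℤ) * (mesh n : ℤ) ∣ κ k := by
      have : (mesh (n + 1) : ℤ) = 5 * (mesh n : ℤ) := by rw [mesh_succ]; push_cast; ring
      rwa [this] at h
    obtain ⟨h5, hpar⟩ := dvd_parent5_of_dvd h'
    have hd0 : (digit5 κ k : ℕ) = 0 := by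
      have : ((digit5 κ k : ℕ) : ℤ) = 0 := by rw [natCast_digit5, h5]
      exact_mod_cast this
    rw [hS.child_boundary_lo _ _ _ hd0]
    exact fun hc => ih (parent5 κ) hpar hc.1

/-- **No gate on the upper outer sides**: if `2·5ⁿ ∣ κ_k + 1`, the block placed on the cell `κ`
at level `n` has no gate on its face `{z_k = 1}`. [cite: AlbertiCrippaMazzucato2019, §8.6] -/
theorem IsCompatibleBlockSystem.not_gate_hi_of_dvd (n : ℕ) (κ : Fin 2 → ℤ) (k : Fin 2) (h : (mesh n : ℤ) ∣ κ k + 1) :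
    ¬ gate (blockLabel child seed n κ) k true := by
  induction n generalizing κ with
  | zero =>
    rw [blockLabel_zero]
    apply hS.seed_boundary_hi
    have h2 : κ k % 2 = 1 := by
      have hm : (mesh 0 : ℤ) = 2 := by simp [mesh]
      rw [hm] at h
      omega
    have : ((seedIndex κ k : ℕ) : ℤ) = 1 := by rw [natCast_seedIndex, h2]
    exact_mod_cast this
  | succ n ih =>
    rw [blockLabel_succ]
    have h' : (5 : ℤ) * (mesh n : ℤ) ∣ κ k + 1 := by
      have : (mesh (n + 1) : ℤ) = 5 * (mesh n : ℤ) := by rw [mesh_succ]; push_cast; ring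
      rwa [this] at h
    obtain ⟨h5, hpar⟩ := dvd_parent5_succ_of_dvd h'
    have hd4 : (digit5 κ k : ℕ) = 4 := by
      have : ((digit5 κ k : ℕ) : ℤ) = 4 := by rw [natCast_digit5, h5]
      exact_mod_cast this
    rw [hS.child_boundary_hi _ _ _ hd4]
    exact fun hc => ih (parent5 κ) hpar hc.1

/-- **Gates match across internal interfaces**: if `2·5ⁿ ∤ κ_k`, the block on the cell `κ` has a
gate on `{z_k = 0}` iff the block on the lower neighbour `κ - e_k` has a gate on `{z_k = 1}`
(induction on `n`; inside a parent by `child_internal`, across parents by the boundary clauses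
and the induction hypothesis). [cite: AlbertiCrippaMazzucato2019, §8.6] -/
theorem IsCompatibleBlockSystem.gate_lo_iff_gate_hi_of_not_dvd (n : ℕ) (κ : Fin 2 → ℤ) (k : Fin 2)
    (h : ¬ (mesh n : ℤ) ∣ κ k) :
    gate (blockLabel child seed n κ) k false ↔
      gate (blockLabel child seed n (κ - Pi.single k 1)) k true := by
  induction n generalizing κ with
  | zero =>
    rw [blockLabel_zero, blockLabel_zero]
    have hm : (mesh 0 : ℤ) = 2 := by simp [mesh]
    rw [hm] at h
    have h1 : κ k % 2 = 1 := by omega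
    have h0 : (κ k - 1) % 2 = 0 := by omega
    -- `seedIndex κ = update (seedIndex (κ - e_k)) k 1`
    have hq0 : (seedIndex (κ - Pi.single k 1) k : ℕ) = 0 := by
      have : ((seedIndex (κ - Pi.single k 1) k : ℕ) : ℤ) = 0 := by
        rw [natCast_seedIndex]; simpa using h0
      exact_mod_cast this
    have hlt : (seedIndex (κ - Pi.single k 1) k : ℕ) + 1 < 2 := by rw [hq0]; norm_num
    have hupd : update (seedIndex (κ - Pi.single k 1)) k ⟨_, hlt⟩ = seedIndex κ := by
      funext j
      by_cases hj : j = k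
      · subst hj
        rw [update_self]
        apply Fin.ext
        have : ((seedIndex κ j : ℕ) : ℤ) = 1 := by rw [natCast_seedIndex, h1]
        have h1' : (seedIndex κ j : ℕ) = 1 := by exact_mod_cast this
        simp [hq0, h1']
      · rw [update_of_ne hj]
        apply Fin.ext
        show ((κ - Pi.single k 1 : Fin 2 → ℤ) j % 2).toNat = (κ j % 2).toNat
        simp [Pi.single_eq_of_ne hj]
    have := hS.seed_internal (seedIndex (κ - Pi.single k 1)) k hlt
    rw [hupd] at this
    exact this.symm
  | succ n ih =>
    rw [blockLabel_succ, blockLabel_succ]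
    have hmesh : (mesh (n + 1) : ℤ) = 5 * (mesh n : ℤ) := by rw [mesh_succ]; push_cast; ring
    rw [hmesh] at h
    by_cases h5 : κ k % 5 = 0
    · -- across the side of the parent
      obtain ⟨hpar, hd4, hd0, hdj⟩ := digit5_sub_single_of_eq κ k h5
      have hnd : ¬ (mesh n : ℤ) ∣ parent5 κ k := not_dvd_parent5 h5 h
      rw [hS.child_boundary_lo _ _ _ hd0, hpar, hS.child_boundary_hi _ _ _ hd4, ih (parent5 κ) hnd]
      constructor
      · rintro ⟨hg, hj⟩
        exact ⟨hg, fun j hjk => by rw [hdj j hjk]; exact hj j hjk⟩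
      · rintro ⟨hg, hj⟩
        exact ⟨hg, fun j hjk => by rw [← hdj j hjk]; exact hj j hjk⟩
    · -- inside the parent
      obtain ⟨hpar, hsucc, hdj⟩ := digit5_sub_single_of_ne κ k h5
      have hlt : (digit5 (κ - Pi.single k 1) k : ℕ) + 1 < 5 := by rw [hsucc]; exact (digit5 κ k).isLt
      have hupd : update (digit5 (κ - Pi.single k 1)) k ⟨_, hlt⟩ = digit5 κ := by
        funext j
        by_cases hj : j = k
        · subst hj; rw [update_self]; exact Fin.ext hsucc
        · rw [update_of_ne hj, hdj j hj]
      have := hS.child_internal (blockLabel child seed n (parent5 (κ - Pi.single k 1)))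
        (digit5 (κ - Pi.single k 1)) k hlt
      rw [hupd, hpar] at this
      rw [hpar]
      exact this.symm

/-- **Gates match across every interface of the tiling** (internal interfaces by the previous
statement; across `∂[0,1]²`, i.e. between the cells `κ_k ≡ 0` and `κ_k ≡ -1 (mod 2·5ⁿ)` of the
periodised tiling, both sides carry no gate). [cite: AlbertiCrippaMazzucato2019, §8.6] -/
theorem IsCompatibleBlockSystem.gate_lo_iff_gate_hi (n : ℕ) (κ : Fin 2 → ℤ) (k : Fin 2) :
    gate (blockLabel child seed n κ) k false ↔
      gate (blockLabel child seed n (κ - Pi.single k 1)) k true := by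
  by_cases h : (mesh n : ℤ) ∣ κ k
  · have h' : (mesh n : ℤ) ∣ (κ - Pi.single k 1 : Fin 2 → ℤ) k + 1 := by simpa using h
    exact iff_of_false (hS.not_gate_lo_of_dvd n κ k h) (hS.not_gate_hi_of_dvd n _ k h')
  · exact hS.gate_lo_iff_gate_hi_of_not_dvd n κ k h

/-! ## Local compatibility of the placed blocks (ACM §8.6) -/

omit hS in
/-- In `Fin 2`, the index different from `k`. [folklore] -/
theorem fin_two_exists_ne (k : Fin 2) : ∀ j : Fin 2, j ≠ k → ∀ j' : Fin 2, j' ≠ k → j' = j := by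
  intro j hj j' hj'
  fin_cases k <;> fin_cases j <;> fin_cases j' <;> simp_all

/-- **Adjacent blocks coincide near the common side** (ACM 2019, §8.6): the blocks placed by
`blockLabel n` are locally compatible in the sense of `Torus.PatchCompatible`, for the scalar and
the velocity simultaneously. [cite: AlbertiCrippaMazzucato2019, §8.6] -/
theorem IsCompatibleBlockSystem.patchCompatible_blocks (n : ℕ) :
    PatchCompatible (blockLabel child seed n) Θ δ ∧ PatchCompatible (blockLabel child seed n) V δ := by
  have hδ := hS.δ_pos
  have hδ8 := hS.δ_le
  -- joint statement
  suffices H : ∀ (κ e : Fin 2 → ℤ), (∀ i, e i = 0 ∨ e i = 1) → ∀ (t : ℝ) (z : EuclideanSpace ℝ (Fin 2)),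
      (∀ i, e i = 1 → |z i| < δ) →
        Θ (blockLabel child seed n κ) t z = Θ (blockLabel child seed n (κ - e)) t (z + latticeVec e) ∧
        V (blockLabel child seed n κ) t z = V (blockLabel child seed n (κ - e)) t (z + latticeVec e) by
    exact ⟨fun κ e he t z hz => (H κ e he t z hz).1, fun κ e he t z hz => (H κ e he t z hz).2⟩
  intro κ e he t z hz
  set L := blockLabel child seed n with hL
  -- the face case, for a unit vector `e = e_k`
  have hface : ∀ k : Fin 2, |z k| < δ →
      Θ (L κ) t z = Θ (L (κ - Pi.single k 1)) t (z + latticeVec (Pi.single k 1)) ∧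
      V (L κ) t z = V (L (κ - Pi.single k 1)) t (z + latticeVec (Pi.single k 1)) := by
    intro k hk
    have hk0 : |z k - faceValue false| < δ := by simpa using hk
    have hk1 : |(z + latticeVec (Pi.single k 1)) k - faceValue true| < δ := by
      simpa [PiLp.add_apply, latticeVec_apply] using hk
    have hzj : ∀ j, j ≠ k → (z + latticeVec (Pi.single k 1)) j = z j := fun j hj => by
      simp [PiLp.add_apply, latticeVec_apply, Pi.single_eq_of_ne hj]
    by_cases hwin : ∀ j, j ≠ k → |z j - 2⁻¹| < 2 * δ
    · have hwin' : ∀ j, j ≠ k → |(z + latticeVec (Pi.single k 1)) j - 2⁻¹| < 2 * δ :=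
        fun j hj => by rw [hzj j hj]; exact hwin j hj
      by_cases hg : gate (L κ) k false
      · have hg' : gate (L (κ - Pi.single k 1)) k true := (hS.gate_lo_iff_gate_hi n κ k).1 hg
        obtain ⟨hV1, hΘ1⟩ := hS.eq_gate (L κ) t z k false hg hk0 hwin
        obtain ⟨hV2, hΘ2⟩ := hS.eq_gate (L (κ - Pi.single k 1)) t _ k true hg' hk1 hwin'
        have hmid : z + latticeVec (Pi.single k 1) - faceMidpoint k true = z - faceMidpoint k false := by
          rw [faceMidpoint_true]; abel
        rw [hmid] at hV2 hΘ2
        exact ⟨hΘ1.trans hΘ2.symm, hV1.trans hV2.symm⟩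
      · have hg' : ¬ gate (L (κ - Pi.single k 1)) k true :=
          fun h' => hg ((hS.gate_lo_iff_gate_hi n κ k).2 h')
        obtain ⟨hV1, hΘ1⟩ := hS.vanish (L κ) t z k false hk0 (Or.inl hg)
        obtain ⟨hV2, hΘ2⟩ := hS.vanish (L (κ - Pi.single k 1)) t _ k true hk1 (Or.inl hg')
        exact ⟨hΘ1.trans hΘ2.symm, hV1.trans hV2.symm⟩
    · push Not at hwin
      obtain ⟨j, hjk, hj⟩ := hwin
      have hj' : δ ≤ |z j - 2⁻¹| := by linarith
      have hj'' : δ ≤ |(z + latticeVec (Pi.single k 1)) j - 2⁻¹| := by rw [hzj j hjk]; exact hj'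
      obtain ⟨hV1, hΘ1⟩ := hS.vanish (L κ) t z k false hk0 (Or.inr ⟨j, hjk, hj'⟩)
      obtain ⟨hV2, hΘ2⟩ := hS.vanish (L (κ - Pi.single k 1)) t _ k true hk1 (Or.inr ⟨j, hjk, hj''⟩)
      exact ⟨hΘ1.trans hΘ2.symm, hV1.trans hV2.symm⟩
  -- case analysis on `e ∈ {0,1}²`
  rcases he 0 with h0 | h0 <;> rcases he 1 with h1 | h1
  · -- `e = 0`
    have he0 : e = 0 := by funext i; fin_cases i <;> assumption
    subst he0
    simp [latticeVec_zero]
  · -- `e = e₁`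
    have he1 : e = Pi.single 1 1 := by funext i; fin_cases i <;> simp [h0, h1]
    subst he1
    exact hface 1 (hz 1 (by simp))
  · -- `e = e₀`
    have he1 : e = Pi.single 0 1 := by funext i; fin_cases i <;> simp [h0, h1]
    subst he1
    exact hface 0 (hz 0 (by simp))
  · -- `e = (1,1)`: both blocks vanish near the corner
    have hz0 : |z 0| < δ := hz 0 h0
    have hz1 : |z 1| < δ := hz 1 h1
    have hk0 : |z 0 - faceValue false| < δ := by simpa using hz0
    have hfar : δ ≤ |z 1 - 2⁻¹| := by
      rw [abs_lt] at hz1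
      rw [abs_sub_comm, abs_of_pos (by linarith)]
      linarith
    obtain ⟨hV1, hΘ1⟩ := hS.vanish (L κ) t z 0 false hk0 (Or.inr ⟨1, by decide, hfar⟩)
    have hk1 : |(z + latticeVec e) 0 - faceValue true| < δ := by
      simpa [PiLp.add_apply, latticeVec_apply, h0] using hz0
    have hfar' : δ ≤ |(z + latticeVec e) 1 - 2⁻¹| := by
      rw [abs_lt] at hz1
      have : (z + latticeVec e) 1 - 2⁻¹ = z 1 + 2⁻¹ := by
        simp [PiLp.add_apply, latticeVec_apply, h1]; ring
      rw [this, abs_of_pos (by linarith)]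
      linarith
    obtain ⟨hV2, hΘ2⟩ := hS.vanish (L (κ - e)) t _ 0 true hk1 (Or.inr ⟨1, by decide, hfar'⟩)
    exact ⟨hΘ1.trans hΘ2.symm, hV1.trans hV2.symm⟩

/-! ## Smoothness of the patched fields (ACM §8.6–8.8; BDL Thm. 4.1) -/

/-- **The patched scalar is smooth on `S × T²`** for every level `n` and time set `S`. [cite: BrueDeLellisCMP2023, Thm. 4.1] -/
theorem IsCompatibleBlockSystem.isSmoothSpaceTimeOn_scalar (n : ℕ) (S : Set ℝ) :
    Torus.IsSmoothSpaceTimeOn S (scalar Θ (blockLabel child seed) n) := by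
  have hc := (hS.patchCompatible_blocks n).1
  have h := isSmoothSpaceTimeOn_patchTorus_of_compatible (m := mesh n) (ι := blockLabel child seed n)
    (G := Θ) (mesh_pos n) hS.smooth_scalar hS.δ_pos (by rw [blockLabel_comp_emod]; exact hc) S
  exact h

/-- **The patched velocity is smooth on `S × T²`** for every level `n` and time set `S`. [cite: BrueDeLellisCMP2023, Thm. 4.1] -/
theorem IsCompatibleBlockSystem.isSmoothSpaceTimeOn_velocity (n : ℕ) (S : Set ℝ) :
    Torus.IsSmoothSpaceTimeOn S (velocity V (blockLabel child seed) n) := by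
  have hc := (hS.patchCompatible_blocks n).2
  have h := isSmoothSpaceTimeOn_patchTorus_of_compatible (m := mesh n) (ι := blockLabel child seed n)
    (G := V) (mesh_pos n) hS.smooth_velocity hS.δ_pos (by rw [blockLabel_comp_emod]; exact hc) S
  exact h.const_smul ((mesh n : ℝ)⁻¹)

/-! ## Per-level supports in the open square (BDL Thm. 4.1 (c); ACM §8.6) -/

/-- The blocks placed on the cells of the fundamental square vanish near `∂[0,1]²`: at a point `y`
of `[0,1)²` with a coordinate `< δ/mₙ` or `> 1 - δ/mₙ`, both patched fields vanish. [cite: AlbertiCrippaMazzucato2019, §8.6] -/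
theorem IsCompatibleBlockSystem.patch_eq_zero_near_boundary (n : ℕ) (t : ℝ) {y : EuclideanSpace ℝ (Fin 2)}
    (hy : y ∈ unitCube (Fin 2)) {i : Fin 2}
    (hi : y i < δ / mesh n ∨ 1 - δ / mesh n < y i) :
    patchTorus (mesh n) (blockLabel child seed n) (fun l => Θ l t) (proj y) = 0 ∧
      patchTorus (mesh n) (blockLabel child seed n) (fun l => V l t) (proj y) = 0 := by
  have hm := mesh_pos n
  have hm' : (0 : ℝ) < mesh n := by exact_mod_cast hm
  set m := mesh n with hmdef
  set κ := cellIndex m y with hκ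
  set z := cellCoord m y with hz
  have hzdef : ∀ j, z j = (m : ℝ) * y j - κ j := fun j => by
    simp [hz, cellCoord, PiLp.sub_apply, latticeVec_apply, hκ]
  have hκj : ∀ j, κ j = ⌊(m : ℝ) * y j⌋ := fun j => rfl
  -- rewrite both patched fields through the planar patch
  have hΘ : patchTorus m (blockLabel child seed n) (fun l => Θ l t) (proj y) =
      Θ (blockLabel child seed n κ) t z := by
    have h := congrFun (lift_patchTorus hm (blockLabel child seed n) (fun l => Θ l t)) y
    rw [lift_apply] at h
    rw [h, patch_apply, blockLabel_emod]
  have hV : patchTorus m (blockLabel child seed n) (fun l => V l t) (proj y) =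
      V (blockLabel child seed n κ) t z := by
    have h := congrFun (lift_patchTorus hm (blockLabel child seed n) (fun l => V l t)) y
    rw [lift_apply] at h
    rw [h, patch_apply, blockLabel_emod]
  rw [hΘ, hV]
  have hy0 : 0 ≤ y i := (hy i).1
  have hy1 : y i < 1 := (hy i).2
  rcases hi with hlo | hhi
  · -- near the face `{y_i = 0}`: cell with `κ_i = 0`, local coordinate `z_i < δ`
    have hmy : (m : ℝ) * y i < δ := by rwa [lt_div_iff₀ hm', mul_comm] at hlo
    have hδ1 : δ < 1 := by linarith [hS.δ_le]
    have hκ0 : κ i = 0 := by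
      rw [hκj, Int.floor_eq_iff]; push_cast
      exact ⟨by positivity, by linarith⟩
    have hzi : |z i - faceValue false| < δ := by
      rw [faceValue_false, sub_zero, hzdef, hκ0]; push_cast; rw [sub_zero, abs_of_nonneg (by positivity)]
      exact hmy
    have hng : ¬ gate (blockLabel child seed n κ) i false :=
      hS.not_gate_lo_of_dvd n κ i (by rw [hκ0]; exact dvd_zero _)
    obtain ⟨h1, h2⟩ := hS.vanish _ t z i false hzi (Or.inl hng)
    exact ⟨h2, h1⟩
  · -- near the face `{y_i = 1}`: cell with `κ_i = m - 1`, local coordinate `z_i > 1 - δ`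
    have hmy : (m : ℝ) - δ < (m : ℝ) * y i := by
      have h := mul_lt_mul_of_pos_left hhi hm'
      have : (m : ℝ) * (1 - δ / m) = m - δ := by field_simp
      linarith
    have hmy1 : (m : ℝ) * y i < m := by nlinarith
    have hδ1 : δ < 1 := by linarith [hS.δ_le]
    have hκm : κ i = (m : ℤ) - 1 := by
      rw [hκj, Int.floor_eq_iff]; push_cast
      exact ⟨by linarith, by linarith⟩
    have hzi : |z i - faceValue true| < δ := by
      rw [faceValue_true, hzdef, hκm]; push_cast
      rw [abs_lt]; constructor <;> linarith
    have hng : ¬ gate (blockLabel child seed n κ) i true :=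
      hS.not_gate_hi_of_dvd n κ i (by rw [hκm]; simp [hmdef])
    obtain ⟨h1, h2⟩ := hS.vanish _ t z i true hzi (Or.inl hng)
    exact ⟨h2, h1⟩

/-- **Per-level compact supports in the open square** (BDL Thm. 4.1 (c), per level; ACM §8.6):
outside `Kₙ = {y | δ/mₙ ≤ yᵢ ≤ 1 - δ/mₙ}` both patched fields vanish. [cite: BrueDeLellisCMP2023, Thm. 4.1 (c)] -/
theorem IsCompatibleBlockSystem.exists_compact_support (n : ℕ) :
    ∃ K : Set (EuclideanSpace ℝ (Fin 2)), IsCompact K ∧ K ⊆ openSquare ∧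
      ∀ t ∈ Icc (0 : ℝ) 1, ∀ y ∈ unitCube (Fin 2), y ∉ K →
        velocity V (blockLabel child seed) n t (proj y) = 0 ∧
          scalar Θ (blockLabel child seed) n t (proj y) = 0 := by
  have hm' : (0 : ℝ) < mesh n := by exact_mod_cast mesh_pos n
  have hδ := hS.δ_pos
  have hε : 0 < δ / mesh n := div_pos hδ hm'
  have hε1 : δ / mesh n < 1 := by
    rw [div_lt_one hm']
    have : (1 : ℝ) ≤ mesh n := by exact_mod_cast mesh_pos n
    linarith [hS.δ_le]
  refine ⟨{y | ∀ i, y i ∈ Icc (δ / mesh n) (1 - δ / mesh n)}, ?_, ?_, ?_⟩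
  · refine isCompact_closedSquare.of_isClosed_subset ?_ ?_
    · have : {y : EuclideanSpace ℝ (Fin 2) | ∀ i, y i ∈ Icc (δ / mesh n) (1 - δ / mesh n)} =
          ⋂ i, (fun y : EuclideanSpace ℝ (Fin 2) => y i) ⁻¹' Icc (δ / mesh n) (1 - δ / mesh n) := by
        ext y; simp
      rw [this]
      exact isClosed_iInter fun i =>
        isClosed_Icc.preimage (PiLp.continuous_apply 2 (fun _ : Fin 2 => ℝ) i)
    · intro y hy k
      exact ⟨le_trans hε.le (hy k).1, (hy k).2.trans (by linarith)⟩
  · intro y hy k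
    exact ⟨lt_of_lt_of_le hε (hy k).1, lt_of_le_of_lt (hy k).2 (by linarith)⟩
  · intro t _ y hy hyK
    have : ∃ i, y i < δ / mesh n ∨ 1 - δ / mesh n < y i := by
      by_contra hcon
      push Not at hcon
      exact hyK fun i => ⟨(hcon i).1, (hcon i).2⟩
    obtain ⟨i, hi⟩ := this
    obtain ⟨hΘ, hV⟩ := hS.patch_eq_zero_near_boundary n t hy hi
    refine ⟨?_, hΘ⟩
    show ((mesh n : ℝ)⁻¹) • patchTorus (mesh n) (blockLabel child seed n) (fun l => V l t) (proj y) = 0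
    rw [hV, smul_zero]

/-! ## Handover (BDL Thm. 4.1 (d); ACM §6.2) -/

/-- **Handover** `ρ_n(·, 1) = ρ_{n+1}(·, 0)`: on each open subsquare of a cell of level `n` the
level-`n` scalar at time `1` is, by self-similarity of the blocks and the recursion of the labels,
the level-`(n+1)` scalar at time `0`; both are continuous, so they agree everywhere. [cite: BrueDeLellisCMP2023, Thm. 4.1 (d)] -/
theorem IsCompatibleBlockSystem.scalar_handover (n : ℕ) :
    scalar Θ (blockLabel child seed) n 1 = scalar Θ (blockLabel child seed) (n + 1) 0 := by
  apply lift_injective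
  have hm := mesh_pos n
  have hm1 := mesh_pos (n + 1)
  have hmR : (0 : ℝ) < mesh n := by exact_mod_cast hm
  have hmesh : (mesh (n + 1) : ℝ) = 5 * mesh n := by rw [mesh_succ]; push_cast; ring
  -- continuity of both lifts
  have hc1 : Continuous (lift (scalar Θ (blockLabel child seed) n 1)) :=
    ((hS.isSmoothSpaceTimeOn_scalar n (Icc 0 1)).isSmooth_slice
      ⟨zero_le_one, le_rfl⟩).continuous.comp continuous_proj
  have hc2 : Continuous (lift (scalar Θ (blockLabel child seed) (n + 1) 0)) :=
    ((hS.isSmoothSpaceTimeOn_scalar (n + 1) (Icc 0 1)).isSmooth_slice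
      ⟨le_rfl, zero_le_one⟩).continuous.comp continuous_proj
  refine eq_of_forall_eqOn_latticeCellInterior hm1 hc1 hc2 fun κ' y hy => ?_
  -- the two planar patches at `y`
  have h1 : lift (scalar Θ (blockLabel child seed) n 1) y =
      Θ (blockLabel child seed n (cellIndex (mesh n) y)) 1 (cellCoord (mesh n) y) := by
    have h := congrFun (lift_patchTorus hm (blockLabel child seed n) (fun l => Θ l 1)) y
    rw [scalar, h, patch_apply, blockLabel_emod]
  have h2 : lift (scalar Θ (blockLabel child seed) (n + 1) 0) y =
      Θ (blockLabel child seed (n + 1) κ') 0 ((mesh (n + 1) : ℝ) • y - latticeVec κ') := by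
    have h := congrFun (lift_patchTorus hm1 (blockLabel child seed (n + 1)) (fun l => Θ l 0)) y
    rw [scalar, h, patch_apply_of_mem_latticeCell hm1 (latticeCellInterior_subset hy), blockLabel_emod]
  rw [h1, h2]
  -- the level-`n` cell of `y` is the parent of `κ'`
  set κ := cellIndex (mesh n) y with hκ
  have hyi : ∀ i, (κ' i : ℝ) < (mesh (n + 1) : ℝ) * y i ∧ (mesh (n + 1) : ℝ) * y i < κ' i + 1 := by
    intro i
    have hm1R : (0 : ℝ) < mesh (n + 1) := by exact_mod_cast hm1
    obtain ⟨ha, hb⟩ := hy i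
    rw [div_lt_iff₀ hm1R] at ha
    rw [lt_div_iff₀ hm1R] at hb
    exact ⟨by linarith, by linarith⟩
  have hκpar : κ = parent5 κ' := by
    funext i
    rw [hκ, cellIndex_apply, Int.floor_eq_iff]
    show ((κ' i / 5 : ℤ) : ℝ) ≤ (mesh n : ℝ) * y i ∧ (mesh n : ℝ) * y i < ((κ' i / 5 : ℤ) : ℝ) + 1
    obtain ⟨ha, hb⟩ := hyi i
    rw [hmesh] at ha hb
    have hdiv : 5 * (κ' i / 5) + κ' i % 5 = κ' i := by omega
    have hr0 : 0 ≤ κ' i % 5 := by omega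
    have hr5 : κ' i % 5 < 5 := by omega
    have hq : ((κ' i : ℤ) : ℝ) = 5 * ((κ' i / 5 : ℤ) : ℝ) + ((κ' i % 5 : ℤ) : ℝ) := by
      exact_mod_cast hdiv.symm
    have hr0' : (0 : ℝ) ≤ ((κ' i % 5 : ℤ) : ℝ) := by exact_mod_cast hr0
    have hr5' : ((κ' i % 5 : ℤ) : ℝ) ≤ 4 := by
      have : κ' i % 5 ≤ 4 := by omega
      exact_mod_cast this
    constructor <;> nlinarith
  -- the local coordinates: `z' = 5 z - digit`
  set z := cellCoord (mesh n) y with hz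
  have hzdef : z = (mesh n : ℝ) • y - latticeVec κ := rfl
  have hdig : ∀ i, ((digit5 κ' i : ℕ) : ℝ) = (κ' i : ℝ) - 5 * (κ i : ℝ) := by
    intro i
    have := parent5_digit5 κ' i
    rw [← hκpar] at this
    have : (((digit5 κ' i : ℕ) : ℤ) : ℝ) = ((κ' i : ℤ) : ℝ) - 5 * ((κ i : ℤ) : ℝ) := by
      have h' : ((digit5 κ' i : ℕ) : ℤ) = κ' i - 5 * κ i := by linarith
      exact_mod_cast h'
    exact_mod_cast this
  have hz' : (mesh (n + 1) : ℝ) • y - latticeVec κ' =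
      (5 : ℝ) • z - latticeVec (fun k => ((digit5 κ' k : ℕ) : ℤ)) := by
    ext i
    simp only [hzdef, PiLp.sub_apply, PiLp.smul_apply, smul_eq_mul, latticeVec_apply, hmesh,
      Int.cast_natCast]
    rw [hdig i]
    ring
  have hzint : z ∈ latticeCellInterior 5 (fun k => ((digit5 κ' k : ℕ) : ℤ)) := by
    intro i
    have hzi : z i = (mesh n : ℝ) * y i - κ i := by
      simp [hzdef, PiLp.sub_apply, latticeVec_apply]
    obtain ⟨ha, hb⟩ := hyi i
    rw [hmesh] at ha hb
    simp only [Int.cast_natCast, Nat.cast_ofNat, mem_Ioo]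
    rw [hdig i, hzi, div_lt_iff₀ (by norm_num : (0 : ℝ) < 5),
      lt_div_iff₀ (by norm_num : (0 : ℝ) < 5)]
    constructor <;> nlinarith
  rw [hS.selfSimilar (blockLabel child seed n κ) (digit5 κ') z hzint, blockLabel_succ, ← hκpar, hz']

/-! ## The building-block family (BDL §4.1 (i)–(iv)) -/

/-- **The blocks of a compatible system are a building-block family** in the sense of
`QuasiSelfSimilar.IsBuildingBlockFamily` (BDL §4.1 (i)–(iv)); zero average and unit mass for all
`t ∈ [0,1]` follow from their values at `t = 0` by conservation under the tangential
incompressible transport (`BoxTransport.setIntegral_unitCube_eq_of_transport'`). [cite: BrueDeLellisCMP2023, §4.1 (i)–(iv)] -/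
theorem IsCompatibleBlockSystem.isBuildingBlockFamily : IsBuildingBlockFamily V Θ where
  smooth_velocity := hS.smooth_velocity
  smooth_scalar := hS.smooth_scalar
  divFree := hS.divFree
  tangent := hS.tangent
  zeroMean i t ht := by
    have h := BoxTransport.setIntegral_unitCube_eq_of_transport' (n := 1) (V := V i) (Θ := Θ i)
      (a := 0) (b := 1) ((hS.smooth_velocity i).of_le ENat.LEInfty.out)
      ((hS.smooth_scalar i).of_le ENat.LEInfty.out)
      (fun s hs z hz => hS.divFree i s hs z hz) (fun s hs z hz => hS.tangent i s hs z hz)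
      (fun s hs z hz => hS.transport i s hs z hz) ht
    rw [h]
    exact hS.zeroMean_zero i
  unitL2 i t ht := by
    have h := BoxTransport.setIntegral_unitCube_sq_eq_of_transport (n := 1) (V := V i) (Θ := Θ i)
      (a := 0) (b := 1) ((hS.smooth_velocity i).of_le ENat.LEInfty.out)
      ((hS.smooth_scalar i).of_le ENat.LEInfty.out)
      (fun s hs z hz => hS.divFree i s hs z hz) (fun s hs z hz => hS.tangent i s hs z hz)
      (fun s hs z hz => hS.transport i s hs z hz) ht
    rw [h]
    exact hS.unitL2_zero i
  transport := hS.transport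
  selfSimilar i p := ⟨child i p, fun z hz => hS.selfSimilar i p z hz⟩
  abs_le := hS.abs_le

end Gates

end QuasiSelfSimilar

open QuasiSelfSimilar FunctionSpaces

/-- **Compatible blocks give the building blocks of BDL Thm. 4.1** (Alberti–Crippa–Mazzucato 2019,
§6.2 induction + §8.6–8.8 gluing; Bruè–De Lellis 2023, Thm. 4.1 structure): from
`acm_compatible_blocks` the structural fact `acm_building_blocks` follows, with the labels
`QuasiSelfSimilar.blockLabel child seed`. [cite: AlbertiCrippaMazzucato2019, §6.2 and §8.6] -/
theorem acm_building_blocks_of_compatible_blocks (h : acm_compatible_blocks) : acm_building_blocks := by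
  obtain ⟨N, V, Θ, gate, child, seed, Vg, Θg, δ, hS⟩ := h
  exact ⟨N, V, Θ, blockLabel child seed, hS.isBuildingBlockFamily,
    fun n => ⟨hS.isSmoothSpaceTimeOn_scalar n _, hS.isSmoothSpaceTimeOn_velocity n _⟩,
    fun n => hS.exists_compact_support n, fun n => hS.scalar_handover n⟩

/-- **The torus family of BDL Thm. 4.1 from compatible blocks**: `acm_compatible_blocks` implies
`alberti_crippa_mazzucato_family` (through `acm_building_blocks` and the accepted
`alberti_crippa_mazzucato_family_of_building_blocks`). [cite: BrueDeLellisCMP2023, Thm. 4.1] -/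
theorem alberti_crippa_mazzucato_family_of_compatible_blocks (h : acm_compatible_blocks) :
    alberti_crippa_mazzucato_family :=
  alberti_crippa_mazzucato_family_of_building_blocks (acm_building_blocks_of_compatible_blocks h)

/-- **The planar family of BDL Thm. 4.1 from compatible blocks**: `acm_compatible_blocks` implies
`alberti_crippa_mazzucato_planar_family`. [cite: BrueDeLellisCMP2023, Thm. 4.1] -/
theorem alberti_crippa_mazzucato_planar_family_of_compatible_blocks (h : acm_compatible_blocks) :
    alberti_crippa_mazzucato_planar_family :=
  alberti_crippa_mazzucato_planar_family_of_acm_building_blocks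
    (acm_building_blocks_of_compatible_blocks h)

end Literature.Analysis.FluidPDE

end
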